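import Summits.ResolutionOfSingularities.ResolutionOfSingularities.Theorems.PurelyInseparableDim4ResConeRotationPartner
import Summits.ResolutionOfSingularities.ResolutionOfSingularities.Theorems.PurelyInseparableDim4SwapRelation
import Summits.ResolutionOfSingularities.ResolutionOfSingularities.Theorems.PurelyInseparableDim4TschirnhausFrameStep
import Summits.ResolutionOfSingularities.ResolutionOfSingularities.Theorems.PurelyInseparableDim4TschirnhausChain
import HarnessLib
import HarnessLib.Audit.Tags

/-!
# Purely inseparable four-folds — K24a-R1′: the FRAMED swap relation of a rotation step (Tschirnhaus frames as
# unit-class relations; the composite relation framed partner ← framed real child) (cell `res-dim4-pi`, K2(p) lane,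
# slice B brick K24a, part R1c, file 2)

[OURS · counted 0 · cell `res-dim4-pi` · K2(p) lane (holder res-dim4-p-12; R1′(β) route agreed 2026-08-29 04:06Z /
04:43Z); seat res-dim4-p-1 g4 over its own `…ResConeRotationPartner` (`rotation_partner_rel`, SN1) and res-dim4-p-7's
`…SwapRelation` (`SwapNorm.rel_comp`, the composition of unit-class relations).]  Nothing here proves K2(p)/K2(5),
`NoIsolatedTrap p p` or resolution of singularities in dimension ≥ 4 / characteristic `p`.  AI kernel work, weaker
than expert review.

SETTING (a rotation step of the two-slot tail).  Parent `s` with `x^p`-high support, letters `a ≠ f`, `τ τ′ = 1`;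
the REAL child `A := step p univ f (τ′·e_a) s` (chart = the free letter `f`, the slot `a` is lost and becomes A's
free letter) and its SWAP PARTNER `B := step p univ a (τ·e_f) s` (a slot step charting `a`, free letter `f`).  A is
read in a Tschirnhaus frame `ψ_A` at `a` (`a ∉ vars ψ_A`, `ψ_A(0) = 0`), B in a frame `ψ_B` at `f`; the FRAMED
polynomials are `S̃_A := clean (τ_{ψ_A} A.F)`, `S̃_B := clean (τ_{ψ_B} B.F)`.

* §1 `rel_tsch`, `rel_tsch_neg` — a Tschirnhaus frame and its inverse as unit-class relations along `π = 1`
  (`e ≡ 1`, `G = ±ψ`, `U = 1`, `E = 0`); `coeff_single_eq_zero_of_not_mem_vars`.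
* §2 **`rotation_frame_rel`** — composing `[τ_{−ψ_A}] ∘ [SN1 partner relation] ∘ [τ_{ψ_B}]` by `rel_comp` twice:
  `S̃_B = clean (U^p · Θ(S̃_A)) + E`, `E ∈ 𝔪^M`, `Θ` a unit-class substitution along `Equiv.swap a f` with B-free
  letter `f` (`Θ (swap a f i) = x_i e_i` for `i ≠ f`, `Θ a = x_f e_f + G`, `e_i(0) ≠ 0`, `G(0) = 0`,
  `coeff_{x_f} G = 0`, `U(0) ≠ 0`) — the input of res-dim4-p-7's graded coefficient transfer
  `SwapNorm.coeff_of_unitClass_rel`.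

[cite: CossartJannsenSaito2020, Thm. 3.14] [cite: Hauser2010, §6 (failure of maximal contact; coordinate changes)]
bears_on: LADDER-RESOLUTION:D157-DOOR2 (res-dim4-pi · K2(p) · slice B · K24a-R1c).  Supports
stmt-ResolutionOfSingularities-16155 (helper).
-/

set_option linter.dupNamespace false -- mandated namespace of this single-conjunct summit

noncomputable section

namespace Summit.ResolutionOfSingularities.ResolutionOfSingularities.Theorems.PIDim4

namespace ResCone

open MvPolynomial Finset FrameChange
open Literature.AlgebraicGeometry.Resolution
open Literature.AlgebraicGeometry.Resolution.CentreBlowup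
open Literature.AlgebraicGeometry.Resolution.Hauser2010
open Literature.AlgebraicGeometry.Resolution.HauserPerlega2019

variable {K : Type} [Field K]

/-! ## §1 Tschirnhaus frames as unit-class relations -/

section Tsch

variable {f : Fin 4} {ψ : MvPolynomial (Fin 4) K}

/-- If `x_f` does not occur in `ψ` then `coeff_{x_f} ψ = 0`. [folklore] -/
theorem coeff_single_eq_zero_of_not_mem_vars (hψ : f ∉ ψ.vars) : coeff (Finsupp.single f 1) ψ = 0 := by
  classical
  by_contra h
  exact hψ ((mem_vars_iff_mem_support f).mpr ⟨Finsupp.single f 1, mem_support_iff.mpr h, by simp⟩)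

/-- The substitution of the Tschirnhaus move `τ_ψ` is a unit-class substitution along `π = 1` with units `1`:
exceptional letters are fixed. [folklore] -/
theorem tschFun_of_ne (ψ : MvPolynomial (Fin 4) K) (i : Fin 4) (hi : i ≠ f) :
    (fun k => if k = f then X f + ψ else X k) ((Equiv.refl (Fin 4)) i) = X i * 1 := by
  dsimp only [Equiv.refl_apply]
  rw [if_neg hi, mul_one]

/-- … and the free letter moves by `ψ`. [folklore] -/
theorem tschFun_self (ψ : MvPolynomial (Fin 4) K) :
    (fun k => if k = f then X f + ψ else X k) ((Equiv.refl (Fin 4)) f) = X f * 1 + ψ := by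
  dsimp only [Equiv.refl_apply]
  rw [if_pos rfl, mul_one]

variable (p : ℕ)

/-- **A Tschirnhaus frame as a relation**: `clean (τ_ψ F) = clean (1^p · θ_ψ(F)) + 0`. [folklore] -/
theorem rel_tsch (F : MvPolynomial (Fin 4) K) :
    deletePthPowers p (tsch f ψ F) =
      deletePthPowers p (1 ^ p * aeval (fun k => if k = f then X f + ψ else X k) F) + 0 := by
  rw [one_pow, one_mul, add_zero]; rfl

variable [hp : Fact p.Prime] [CharP K p]

/-- **The inverse frame as a relation**: for `F` clean and `x_f ∉ ψ`, `F = clean (1^p · θ_{−ψ}(clean (τ_ψ F))) + 0`.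
[folklore] -/
theorem rel_tsch_neg [DecidableEq K] (hψ : f ∉ ψ.vars) {F : MvPolynomial (Fin 4) K} (hF : deletePthPowers p F = F) :
    F = deletePthPowers p (1 ^ p * aeval (fun k => if k = f then X f + -ψ else X k)
      (deletePthPowers p (tsch f ψ F))) + 0 := by
  rw [one_pow, one_mul, add_zero, show aeval (fun k => if k = f then X f + -ψ else X k)
      (deletePthPowers p (tsch f ψ F)) = tsch f (-ψ) (deletePthPowers p (tsch f ψ F)) from rfl,
    deletePthPowers_tsch_neg_deletePthPowers_tsch (p := p) hψ, hF]

end Tsch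

/-! ## §2 The composite framed relation of a rotation step -/

section Rotation

variable (p : ℕ) [hp : Fact p.Prime] [CharP K p] [DecidableEq K]

/-- **THE FRAMED SWAP RELATION OF A ROTATION STEP** (K24a-R1c; setting in the module docstring).  For the real child
`A = step p univ f (τ′·e_a) s` framed by `ψ_A` at its free letter `a` and the swap partner
`B = step p univ a (τ·e_f) s` framed by `ψ_B` at its free letter `f` (`τ τ′ = 1`, `M ≥ 1`):
`clean (τ_{ψ_B} B.F) = clean (U^p · Θ(clean (τ_{ψ_A} A.F))) + E` with `E ∈ 𝔪^M` and `Θ` a unit-class substitution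
along `Equiv.swap a f` with free letter `f`. [OURS · `rel_tsch_neg` ∘ `rotation_partner_rel` ∘ `rel_tsch` by
`SwapNorm.rel_comp`] [cite: CossartJannsenSaito2020, Thm. 3.14] -/
theorem rotation_frame_rel {s : State K} (hF : (p : ℕ∞) ≤ ordAlong Finset.univ s.F) {a f : Fin 4} (haf : a ≠ f)
    {τ τ' : K} (hττ' : τ * τ' = 1) {M : ℕ} (hM : 1 ≤ M) {ψA ψB : MvPolynomial (Fin 4) K} (hψA : a ∉ ψA.vars)
    (h0ψA : constantCoeff ψA = 0) (hψB : f ∉ ψB.vars) (h0ψB : constantCoeff ψB = 0) :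
    ∃ (Θ e : Fin 4 → MvPolynomial (Fin 4) K) (G U E : MvPolynomial (Fin 4) K),
      (∀ i, i ≠ f → Θ (Equiv.swap a f i) = X i * e i) ∧ Θ (Equiv.swap a f f) = X f * e f + G ∧
      (∀ i, constantCoeff (e i) ≠ 0) ∧ constantCoeff G = 0 ∧ coeff (Finsupp.single f 1) G = 0 ∧
      constantCoeff U ≠ 0 ∧ E ∈ originIdeal K ^ M ∧
      deletePthPowers p (tsch f ψB (CentreBlowup.step p Finset.univ a (Pi.single f τ : Fin 4 → K) s).F) =
        deletePthPowers p (U ^ p * aeval Θ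
          (deletePthPowers p (tsch a ψA (CentreBlowup.step p Finset.univ f (Pi.single a τ' : Fin 4 → K) s).F))) + E := by
  set A := CentreBlowup.step p Finset.univ f (Pi.single a τ' : Fin 4 → K) s with hA
  set B := CentreBlowup.step p Finset.univ a (Pi.single f τ : Fin 4 → K) s with hB
  have hπf : Equiv.swap a f f = a := Equiv.swap_apply_right a f
  -- (1) the inverse frame of `A`: `A.F ← S̃_A`, along `1`, free letter `a = swap a f f`
  have hAclean : deletePthPowers p A.F = A.F := deletePthPowers_step_F p Finset.univ f _ s
  have hrel₁ := rel_tsch_neg p hψA hAclean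
  have h1i : ∀ k, k ≠ Equiv.swap a f f →
      (fun k => if k = a then X a + -ψA else X k) ((Equiv.refl (Fin 4)) k) = X k * 1 := by
    rw [hπf]; exact tschFun_of_ne (-ψA)
  have h1f : (fun k => if k = a then X a + -ψA else X k) ((Equiv.refl (Fin 4)) (Equiv.swap a f f)) =
      X (Equiv.swap a f f) * 1 + -ψA := by
    rw [hπf]; exact tschFun_self (-ψA)
  have hG₁1 : coeff (Finsupp.single (Equiv.swap a f f) 1) (-ψA) = 0 := by
    rw [hπf, coeff_neg, coeff_single_eq_zero_of_not_mem_vars hψA, neg_zero]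
  have hG₁0 : constantCoeff (-ψA) = 0 := by rw [map_neg, h0ψA, neg_zero]
  -- (2) the partner relation `B.F ← A.F`, along `swap a f`, free letter `f`, `G = 0`
  obtain ⟨θ₂, e₂, E₂, hθ₂, he₂, -, hE₂, hrel₂, -⟩ := rotation_partner_rel p hF haf hττ' hM
  have h2f : θ₂ (Equiv.swap a f f) = X f * e₂ f + 0 := by rw [hθ₂, add_zero]
  have hU₂ : constantCoeff (X f + C τ : MvPolynomial (Fin 4) K) ≠ 0 := by
    rw [map_add, constantCoeff_X, constantCoeff_C, zero_add]
    exact fun h0 => by rw [h0, zero_mul] at hττ'; exact zero_ne_one hττ'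
  obtain ⟨Θ₁, e₁, G₁, U₁, E₁, hΘ₁i, hΘ₁f, he₁, hG₁0', hG₁1', hU₁, hE₁, hrel₁₂⟩ :=
    SwapNorm.rel_comp p (π := Equiv.swap a f) (ρ := Equiv.refl (Fin 4)) (f := f) (M₁ := M) (M₂ := M)
      h1i h1f (fun _ => by rw [map_one]; exact one_ne_zero) hG₁0 hG₁1 (U₁ := 1)
      (by rw [map_one]; exact one_ne_zero)
      (Ideal.zero_mem _) hrel₁ (fun i _ => hθ₂ i) h2f he₂ (map_zero _)
      (by rw [coeff_zero]) hU₂ hE₂ hrel₂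
  rw [Equiv.trans_refl] at hΘ₁i hΘ₁f
  -- (3) the frame of `B`: `S̃_B ← B.F`, along `1`, free letter `f`
  have hrel₃ := rel_tsch p (f := f) (ψ := ψB) B.F
  obtain ⟨Θ, e, G, U, E, hΘi, hΘf, he, hG0, hG1, hU, hE, hrel⟩ :=
    SwapNorm.rel_comp p (π := Equiv.refl (Fin 4)) (ρ := Equiv.swap a f) (f := f) (M₁ := min M M) (M₂ := M)
      (fun k hk => hΘ₁i k (by simpa using hk)) (by simpa using hΘ₁f) he₁ hG₁0' (by simpa using hG₁1') hU₁ hE₁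
      hrel₁₂ (tschFun_of_ne ψB) (tschFun_self ψB) (fun _ => by rw [map_one]; exact one_ne_zero) h0ψB
      (coeff_single_eq_zero_of_not_mem_vars hψB) (U₂ := 1) (by rw [map_one]; exact one_ne_zero)
      (Ideal.zero_mem _) hrel₃
  refine ⟨Θ, e, G, U, E, fun i hi => ?_, ?_, he, hG0, hG1, hU, by simpa using hE, hrel⟩
  · simpa using hΘi i hi
  · simpa using hΘf

end Rotation

end ResCone

end Summit.ResolutionOfSingularities.ResolutionOfSingularities.Theorems.PIDim4

end
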